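import Summits.ValiantsHypothesis.ValiantsHypothesis.Theorems.SymPencilPerFourCrossSixFront
import Summits.ValiantsHypothesis.ValiantsHypothesis.Theorems.SymPencilPerFourCrossSixEndgame
import Summits.ValiantsHypothesis.ValiantsHypothesis.Theorems.SymPencilBasePointDetConst

/-!
# Route `SymPencil` — the cross space `V×` is NOT the kernel space of a size-`27` symmetric
# representation of `per_4` (cell `(10,6,6)`, the `V`-immortal candidate dies by PENCIL input;
# `--supports` stmt-ValiantsHypothesis-5674 `SdcSuperquadratic`; rung currency only — nothing
# here bears on `VP ≠ VNP`)

`V× = row 0 ⊕ k E₁₀ ⊕ k E₂₀` is the `6`-dimensional singular subspace of `per_4` that carries a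
joint family of exactly six squares (`SymPencilPerFourSixDimJointSix.exists_jointFamily_six_six`),
so the subspace abstraction of the size-`27` kernel-package table cannot exclude it in the cell
`(10, 6, 6)` (`Cruxes/SdcSuperquadratic/TORIC-SIX.md` §X).  **Theorem** (`false_of_ker_eq_cross`):
in the base-point package (`SymPencilPerFourBasePointPackage`) with `|ι'| ≤ 26`,
`dim (im bL) ≥ 10`, kernel space exactly `V×`, and `det (D + t CL v) = det D` along the kernel
(automatic over an algebraically closed field, `SymPencilBasePointDetConst`), one gets `False`;
`false_of_ker_eq_cross_of_isAlgClosed` is the algebraically-closed form.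

Proof = the AFFINE LEVER (`SymPencilAffineKernelLever`) along `a = E₀₁ + E₀₂ + E₀₃ ∈ V×`:
`SymPencilPerFourCrossSixFront.cross_front` makes the kernel rows `B₁₂` of
`X₀ = {rows 1,2 × cols 1..3} ⊕ k E₃₀` invariant under `N = C(a)D⁻¹`; transporting `N` to a linear
`K'` on `X₀ ≅ k × k^{2×3}` and reading the base-point identity at `t a` on the point
`x + t K' x` (`SymPencilBasePointMoments.basepoint_moment`, as in the one-row cell
`SymPencilPerFourOneRowKernel`) gives, with `det (D + t CL a) = det D`,
`det D · t · Θ(x)[K' x] = κ t · F(x + t K' x)` for the cubic `F(ω, r) = ω · r₁ᵀ A r₂`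
(`A = 𝟙𝟙ᵀ - 1`); four values of `t` yield the flow invariance `F(x + t K' x) = F(x)` and the NC1
identity `det D · Θ(x)[K' x] = κ F(x)`, which `SymPencilPerFourCrossSixEndgame.false_of_cross_endgame`
refutes (parity of skew maps on the split quadratic `6`-space).

What this does NOT do: the other candidates of the cell `(10,6,6)` (two-row subspaces with
`det S ≡ 0`, the exotic `V₁` of `SymPencilPerFourSixDimExotic`, …) are untouched; the window
`27 ≤ sdc(per₄) ≤ 29` is unchanged.  No definitions, no named facts. [folklore]
-/

noncomputable section

-- single-conjunct layout: Sub = Summit, duplicated namespace component intended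
set_option linter.dupNamespace false

namespace Summit.ValiantsHypothesis.ValiantsHypothesis.Theorems.SymPencilPerFourCrossSix

open Matrix MvPolynomial Module
open Literature.Computability.AlgebraicComplexity
open Summit.ValiantsHypothesis.ValiantsHypothesis.Theorems.SymPencilLagrangianKernel
open Summit.ValiantsHypothesis.ValiantsHypothesis.Theorems.SymPencilBasePointMoments
open Summit.ValiantsHypothesis.ValiantsHypothesis.Theorems.SymPencilPerFourCrossSixForms
open Summit.ValiantsHypothesis.ValiantsHypothesis.Theorems.SymPencilPerFourCrossSixFront
open Summit.ValiantsHypothesis.ValiantsHypothesis.Theorems.SymPencilPerFourCrossSixQuadratic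
open Summit.ValiantsHypothesis.ValiantsHypothesis.Theorems.SymPencilPerFourCrossSixEndgame
open Summit.ValiantsHypothesis.ValiantsHypothesis.Theorems.SymPencilBasePointDetConst

universe u

variable {k : Type u} [Field k] [CharZero k] {ι' : Type*} [Fintype ι'] [DecidableEq ι']

/-- Four values of `t` determine a cubic: if `E = κ (c₁ t + c₂ t² + c₃ t³)` for `t = ±1, ±2`
(`κ ≠ 0`), then `E = c₁ = c₂ = c₃ = 0`. [folklore] -/
theorem cubic_four_values {E κ c₁ c₂ c₃ : k} (hκ : κ ≠ 0)
    (h1 : E = κ * (c₁ * 1 + c₂ * 1 ^ 2 + c₃ * 1 ^ 3))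
    (h2 : E = κ * (c₁ * (-1) + c₂ * (-1) ^ 2 + c₃ * (-1) ^ 3))
    (h3 : E = κ * (c₁ * 2 + c₂ * 2 ^ 2 + c₃ * 2 ^ 3))
    (h4 : E = κ * (c₁ * (-2) + c₂ * (-2) ^ 2 + c₃ * (-2) ^ 3)) :
    E = 0 ∧ c₁ = 0 ∧ c₂ = 0 ∧ c₃ = 0 := by
  have e3 : κ * (12 * c₃) = 0 := by linear_combination -(h3 - h4) + 2 * (h1 - h2)
  have hc₃ : c₃ = 0 :=
    (mul_eq_zero.1 ((mul_eq_zero.1 e3).resolve_left hκ)).resolve_left (by norm_num)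
  have e1 : κ * (2 * c₁) = 0 := by linear_combination -(h1 - h2) - 2 * κ * hc₃
  have hc₁ : c₁ = 0 :=
    (mul_eq_zero.1 ((mul_eq_zero.1 e1).resolve_left hκ)).resolve_left two_ne_zero
  have e2 : κ * (6 * c₂) = 0 := by linear_combination (h1 + h2) - (h3 + h4)
  have hc₂ : c₂ = 0 :=
    (mul_eq_zero.1 ((mul_eq_zero.1 e2).resolve_left hκ)).resolve_left (by norm_num)
  refine ⟨?_, hc₁, hc₂, hc₃⟩
  rw [h1, hc₁, hc₂, hc₃]; ring

/-- **The cross space `V×` is not the kernel space of a size-`27` symmetric representation of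
`per_4`** (base-point package form, with the determinant constancy `det (D + t CL v) = det D`
along the kernel as a hypothesis).  See the module docstring. [folklore] -/
theorem false_of_ker_eq_cross {D : Matrix ι' ι' k} (hD : IsUnit D.det) (hDs : Dᵀ = D)
    (bL : (Fin 4 × Fin 4 → k) →ₗ[k] (ι' → k)) (CL : (Fin 4 × Fin 4 → k) →ₗ[k] Matrix ι' ι' k)
    (hCs : ∀ z, (CL z)ᵀ = CL z) {κ : k} (hκ : κ ≠ 0)
    (hii : ∀ z, bL z ⬝ᵥ (D⁻¹ * CL z * D⁻¹) *ᵥ bL z = 0)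
    (hN : ∀ v, bL v = 0 → IsUnit (D + CL v).det ∧ ∀ (z : Fin 4 × Fin 4 → k) (s : k),
      κ * MvPolynomial.eval (v + s • z) (perPoly (Fin 4) k) =
        (Matrix.fromBlocks ((s * 0) • (1 : Matrix Unit Unit k))
          (Matrix.replicateRow Unit (s • bL z)) (Matrix.replicateCol Unit (s • bL z))
          (D + CL v + s • CL z)).det)
    (hker : ∀ x : Fin 4 × Fin 4 → k,
      bL x = 0 ↔ ∀ z : Fin 4 × Fin 4, ¬ (z.1 = 0 ∨ z = (1, 0) ∨ z = (2, 0)) → x z = 0)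
    (h10 : 10 ≤ finrank k (LinearMap.range bL)) (hcard : Fintype.card ι' ≤ 26)
    (hdet : ∀ v, bL v = 0 → ∀ t : k, (D + t • CL v).det = D.det) : False := by
  classical
  have hDis : (D⁻¹)ᵀ = D⁻¹ := by rw [Matrix.transpose_nonsing_inv, hDs]
  -- the cubic `F(ω, r) = ω q(r)`
  set A₃ : Matrix (Fin 3) (Fin 3) k := Matrix.of ![![0, 1, 1], ![1, 0, 1], ![1, 1, 0]] with hA₃
  let q : (Fin 2 × Fin 3 → k) → k := fun r => ∑ i, ∑ j, r (0, i) * A₃ i j * r (1, j)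
  have hq : ∀ r, q r = ∑ i, ∑ j, r (0, i) * A₃ i j * r (1, j) := fun r => rfl
  have hq' : ∀ r : Fin 2 × Fin 3 → k, q r = r (0, 0) * (r (1, 1) + r (1, 2)) +
      r (0, 1) * (r (1, 0) + r (1, 2)) + r (0, 2) * (r (1, 0) + r (1, 1)) := fun r => by
    simp only [hq, hA₃, Fin.sum_univ_three]
    simp; ring
  let β : (Fin 2 × Fin 3 → k) → (Fin 2 × Fin 3 → k) → k := fun r s =>
    ∑ i, ∑ j, (r (0, i) * A₃ i j * s (1, j) + s (0, i) * A₃ i j * r (1, j))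
  have hβ : ∀ r s, β r s = ∑ i, ∑ j, (r (0, i) * A₃ i j * s (1, j) + s (0, i) * A₃ i j * r (1, j)) :=
    fun r s => rfl
  have hA₃s : A₃ᵀ = A₃ := by
    rw [hA₃]; ext i j; fin_cases i <;> fin_cases j <;> simp [Matrix.transpose_apply]
  have hA₃u : IsUnit A₃.det := by
    rw [hA₃, Matrix.det_fin_three]; simp
  -- the direction `a` and the embedding of `X₀`
  set a : Fin 4 × Fin 4 → k := fun z =>
    (Matrix.of ![![0, 1, 1, 1], ![0, 0, 0, 0], ![0, 0, 0, 0], ![0, 0, 0, 0]]) z.1 z.2 with ha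
  have ha_ker : ∀ t : k, bL (t • a) = 0 := fun t =>
    (hker _).2 fun z hz => cross_a_off_row t z.1 z.2 fun h => hz (Or.inl h)
  let embX : (k × (Fin 2 × Fin 3 → k)) →ₗ[k] (Fin 4 × Fin 4 → k) :=
    { toFun := fun x z => (Matrix.of ![![0, 0, 0, 0], ![0, x.2 (0, 0), x.2 (0, 1), x.2 (0, 2)],
        ![0, x.2 (1, 0), x.2 (1, 1), x.2 (1, 2)], ![x.1, 0, 0, 0]]) z.1 z.2
      map_add' := fun x y => by
        funext z; obtain ⟨i, j⟩ := z
        fin_cases i <;> fin_cases j <;> simp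
      map_smul' := fun c x => by
        funext z; obtain ⟨i, j⟩ := z
        fin_cases i <;> fin_cases j <;> simp }
  have hembX : ∀ x : k × (Fin 2 × Fin 3 → k), embX x = fun z : Fin 4 × Fin 4 =>
      (Matrix.of ![![0, 0, 0, 0], ![0, x.2 (0, 0), x.2 (0, 1), x.2 (0, 2)],
        ![0, x.2 (1, 0), x.2 (1, 1), x.2 (1, 2)], ![x.1, 0, 0, 0]]) z.1 z.2 := fun _ => rfl
  -- `f = bL ∘ embX` is injective
  set f : (k × (Fin 2 × Fin 3 → k)) →ₗ[k] (ι' → k) := bL ∘ₗ embX with hfdef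
  have hf : ∀ x, f x = bL (embX x) := fun x => rfl
  have hfinj : Function.Injective f := by
    rw [← LinearMap.ker_eq_bot, Submodule.eq_bot_iff]
    intro x hx
    rw [LinearMap.mem_ker, hf] at hx
    have h := (hker _).1 hx
    have hval : ∀ i j : Fin 4, ¬ (i = 0 ∨ ((i, j) : Fin 4 × Fin 4) = (1, 0) ∨
        ((i, j) : Fin 4 × Fin 4) = (2, 0)) →
        (Matrix.of ![![0, 0, 0, 0], ![0, x.2 (0, 0), x.2 (0, 1), x.2 (0, 2)],
          ![0, x.2 (1, 0), x.2 (1, 1), x.2 (1, 2)], ![x.1, 0, 0, 0]]) i j = 0 :=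
      fun i j hij => h (i, j) hij
    have h30 : x.1 = 0 := by simpa using hval 3 0 (by simp)
    have h11 : x.2 (0, 0) = 0 := by simpa using hval 1 1 (by simp)
    have h12 : x.2 (0, 1) = 0 := by simpa using hval 1 2 (by simp)
    have h13 : x.2 (0, 2) = 0 := by simpa using hval 1 3 (by simp)
    have h21 : x.2 (1, 0) = 0 := by simpa using hval 2 1 (by simp)
    have h22 : x.2 (1, 1) = 0 := by simpa using hval 2 2 (by simp)
    have h23 : x.2 (1, 2) = 0 := by simpa using hval 2 3 (by simp)
    clear_value embX f
    refine Prod.ext h30 (funext fun p => ?_)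
    obtain ⟨i, j⟩ := p
    rw [Prod.snd_zero, Pi.zero_apply]
    fin_cases i <;> fin_cases j <;> simp [h11, h12, h13, h21, h22, h23]
  -- the transported operator `K'` with `f (K' x) = C(a) D⁻¹ f x`
  have hinv : ∀ x, CL a *ᵥ (D⁻¹ *ᵥ f x) ∈ LinearMap.range f := by
    rintro ⟨ω, r⟩
    obtain ⟨ω', r', h⟩ := cross_front hD hDs bL CL hCs hκ hii hN hker h10 hcard ω r
    refine ⟨(ω', r'), ?_⟩
    rw [hf, hembX, hf, hembX]
    exact h.symm
  let e : (k × (Fin 2 × Fin 3 → k)) ≃ₗ[k] LinearMap.range f := LinearEquiv.ofInjective f hfinj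
  have he : ∀ x, (e x : ι' → k) = f x := fun x => rfl
  let g : (k × (Fin 2 × Fin 3 → k)) →ₗ[k] LinearMap.range f :=
    LinearMap.codRestrict _ ((CL a).mulVecLin ∘ₗ (D⁻¹).mulVecLin ∘ₗ f) fun x => hinv x
  have hg : ∀ x, (g x : ι' → k) = CL a *ᵥ (D⁻¹ *ᵥ f x) := fun x => rfl
  let K' : (k × (Fin 2 × Fin 3 → k)) →ₗ[k] (k × (Fin 2 × Fin 3 → k)) := e.symm.toLinearMap ∘ₗ g
  have hK' : ∀ x, f (K' x) = CL a *ᵥ (D⁻¹ *ᵥ f x) := by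
    intro x
    have h1 : (e (e.symm (g x)) : ι' → k) = (g x : ι' → k) := by rw [e.apply_symm_apply]
    rw [he, hg] at h1
    exact h1
  -- the vector `u`, the form `Θ`
  let u : (k × (Fin 2 × Fin 3 → k)) → (ι' → k) := fun x => D⁻¹ *ᵥ f x
  have hu : ∀ x, u x = D⁻¹ *ᵥ f x := fun x => rfl
  have hDu : ∀ x, D *ᵥ u x = f x := fun x => by
    rw [hu, Matrix.mulVec_mulVec, Matrix.mul_nonsing_inv _ hD, Matrix.one_mulVec]
  set Cm : (k × (Fin 2 × Fin 3 → k)) →ₗ[k] Matrix ι' ι' k := CL ∘ₗ embX with hCmdef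
  have hCm : ∀ y, Cm y = CL (embX y) := fun y => rfl
  have hΘ0 : ∀ x, u x ⬝ᵥ Cm x *ᵥ u x = 0 := fun x => by
    have h := hii (embX x)
    rwa [sandwich₂_eq hDis] at h
  -- the base-point identity along `t ↦ t a`, read on the point `x + t K' x`
  have hmain : ∀ (x : k × (Fin 2 × Fin 3 → k)) (t : k),
      D.det * (t * (u x ⬝ᵥ Cm (K' x) *ᵥ u x)) =
        κ * t * ((x + t • K' x).1 * q (x + t • K' x).2) := by
    intro x t
    obtain ⟨hNt, hdet'⟩ := hN (t • a) (ha_ker t)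
    set y := x + t • K' x with hy
    set z : Fin 4 × Fin 4 → k := embX y with hz
    have hbz : bL z = (D + CL (t • a)) *ᵥ u x := by
      rw [hz, ← hf, hy, map_add, map_smul, hK', map_smul, Matrix.add_mulVec, hDu,
        Matrix.smul_mulVec, hu]
    have hNs : (D + CL (t • a))ᵀ = D + CL (t • a) := by
      rw [Matrix.transpose_add, hDs, hCs]
    have hper : ∀ s : k, MvPolynomial.eval (t • a + s • z) (perPoly (Fin 4) k) =
        s ^ 3 * (t * (y.1 * q y.2)) := fun s => by
      rw [hz, hembX, ha, eval_cross_pencil, hq']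
    have hE : ∀ s : k, (Matrix.fromBlocks ((s * 0) • (1 : Matrix Unit Unit k))
        (Matrix.replicateRow Unit (s • (D + CL (t • a)) *ᵥ u x))
        (Matrix.replicateCol Unit (s • (D + CL (t • a)) *ᵥ u x))
        (D + CL (t • a) + s • CL z)).det =
        s ^ 3 * (κ * t * (y.1 * q y.2)) + s ^ 4 * 0 := by
      intro s
      rw [← hbz, ← hdet' z s, hper]
      ring
    obtain ⟨-, -, h3⟩ := basepoint_moment hNt hNs 0 _ 0 (u x) hE
    have hq2 : u x ⬝ᵥ CL z *ᵥ u x = t * (u x ⬝ᵥ Cm (K' x) *ᵥ u x) := by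
      rw [hz, ← hCm, hy, map_add, map_smul, Matrix.add_mulVec, dotProduct_add, hΘ0, zero_add,
        Matrix.smul_mulVec, dotProduct_smul, smul_eq_mul]
    rw [hq2, map_smul, hdet a (by simpa using ha_ker 1) t] at h3
    exact h3
  -- flow invariance and NC1 from four values of `t`
  have hflowNC : ∀ x : k × (Fin 2 × Fin 3 → k),
      (∀ t : k, (x + t • K' x).1 * q (x + t • K' x).2 = x.1 * q x.2) ∧
        D.det * (u x ⬝ᵥ Cm (K' x) *ᵥ u x) = κ * (x.1 * q x.2) := by
    intro x
    have hexp : ∀ t : k, (x + t • K' x).1 * q (x + t • K' x).2 =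
        x.1 * q x.2 + (((K' x).1 * q x.2 + x.1 * β x.2 (K' x).2) * t +
          ((K' x).1 * β x.2 (K' x).2 + x.1 * q (K' x).2) * t ^ 2 +
          ((K' x).1 * q (K' x).2) * t ^ 3) := by
      intro t
      rw [Prod.fst_add, Prod.snd_add, Prod.smul_fst, Prod.smul_snd, smul_eq_mul,
        q_add_smul A₃ q β hq hβ]
      ring
    have hval : ∀ t : k, t ≠ 0 →
        D.det * (u x ⬝ᵥ Cm (K' x) *ᵥ u x) - κ * (x.1 * q x.2) =
          κ * (((K' x).1 * q x.2 + x.1 * β x.2 (K' x).2) * t +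
            ((K' x).1 * β x.2 (K' x).2 + x.1 * q (K' x).2) * t ^ 2 +
            ((K' x).1 * q (K' x).2) * t ^ 3) := by
      intro t ht
      have h := hmain x t
      rw [hexp] at h
      have h' : t * (D.det * (u x ⬝ᵥ Cm (K' x) *ᵥ u x) - κ * (x.1 * q x.2) -
          κ * (((K' x).1 * q x.2 + x.1 * β x.2 (K' x).2) * t +
            ((K' x).1 * β x.2 (K' x).2 + x.1 * q (K' x).2) * t ^ 2 +
            ((K' x).1 * q (K' x).2) * t ^ 3)) = 0 := by
        linear_combination h
      have := (mul_eq_zero.1 h').resolve_left ht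
      linear_combination this
    obtain ⟨hE, hc1, hc2, hc3⟩ := cubic_four_values hκ (hval 1 one_ne_zero)
      (hval (-1) (by norm_num)) (hval 2 two_ne_zero) (hval (-2) (by norm_num))
    refine ⟨fun t => ?_, by linear_combination hE⟩
    rw [hexp, hc1, hc2, hc3]; ring
  exact false_of_cross_endgame A₃ q β hA₃s hA₃u hq hβ K' u Cm hκ (fun x t => (hflowNC x).1 t)
    (fun x => (hflowNC x).2)

/-- **Algebraically closed form**: over an algebraically closed field of characteristic `0`, the
cross space `V×` is not the kernel space of a size-`≤ 27` base-point package with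
`dim (im bL) ≥ 10` (the determinant constancy is automatic,
`SymPencilBasePointDetConst.det_add_smul_eq_det_of_isAlgClosed`). [folklore] -/
theorem false_of_ker_eq_cross_of_isAlgClosed [IsAlgClosed k] {D : Matrix ι' ι' k}
    (hD : IsUnit D.det) (hDs : Dᵀ = D)
    (bL : (Fin 4 × Fin 4 → k) →ₗ[k] (ι' → k)) (CL : (Fin 4 × Fin 4 → k) →ₗ[k] Matrix ι' ι' k)
    (hCs : ∀ z, (CL z)ᵀ = CL z) {κ : k} (hκ : κ ≠ 0)
    (hii : ∀ z, bL z ⬝ᵥ (D⁻¹ * CL z * D⁻¹) *ᵥ bL z = 0)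
    (hN : ∀ v, bL v = 0 → IsUnit (D + CL v).det ∧ ∀ (z : Fin 4 × Fin 4 → k) (s : k),
      κ * MvPolynomial.eval (v + s • z) (perPoly (Fin 4) k) =
        (Matrix.fromBlocks ((s * 0) • (1 : Matrix Unit Unit k))
          (Matrix.replicateRow Unit (s • bL z)) (Matrix.replicateCol Unit (s • bL z))
          (D + CL v + s • CL z)).det)
    (hker : ∀ x : Fin 4 × Fin 4 → k,
      bL x = 0 ↔ ∀ z : Fin 4 × Fin 4, ¬ (z.1 = 0 ∨ z = (1, 0) ∨ z = (2, 0)) → x z = 0)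
    (h10 : 10 ≤ finrank k (LinearMap.range bL)) (hcard : Fintype.card ι' ≤ 26) : False :=
  false_of_ker_eq_cross hD hDs bL CL hCs hκ hii hN hker h10 hcard fun v hv t =>
    det_add_smul_eq_det_of_isAlgClosed D bL CL (fun w hw => (hN w hw).1) v hv t

end Summit.ValiantsHypothesis.ValiantsHypothesis.Theorems.SymPencilPerFourCrossSix

end
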